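import Summits.SmoothPoincare4.SmoothPoincare4.Theorems.CylinderEntropyCylinderRungTwoKillingFluxDefs
import Literature.Geometry.Riemannian.SphericalCylinderEntropy
import HarnessLib

/-!
# Route `CylinderEntropy`, crux `CylinderRungTwo` (stmt-SmoothPoincare4-7631), line `killing-flux`:
# `AreaToFloor` from `Relaxation` (registered helper `helper_areaToFloorOfRelaxation`)

The converse of the lead's reshape r6 cut of the checked skeleton
`Cruxes/CylinderRungTwo/Lines/killing_flux.lean`.  The cut reduces RELAXATION ("along an immortal smooth
cylinder flow `IsCylinderMCF M F ν T` of a compact connected cross-section of `N = S⁴ × ℝ ⊂ ℝ⁶` with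
separating, `2`-thin time slices, `λ_cyl(M_s)` is eventually below every `1 + ε`") to AREA-TO-FLOOR
("some time slice `M_t`, `t ≥ T`, has `μH⁴(M_t) ≤ (1 + ε) μH⁴(S⁴)`") plus Hamilton monotonicity
(`stub_relaxationOfAreaToFloor`, landed).  This file proves the easy converse

  `helper_areaToFloorOfRelaxation : Relaxation → AreaToFloor`,

so the cut loses nothing: the typed cylinder entropy dominates the area ratio,
`μH⁴(A)/μH⁴(S⁴) ≤ λ_cyl(A)` for every measurable `A ⊆ N` of bounded height (tree
`SphericalCylinderEntropy.measure_ratio_le_cylEntropy`, the `τ → ∞` end of the supremum), and a time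
slice `M_t = F t (M)` of the flow is a compact subset of `N` (continuous image of the compact `M`), hence
measurable and of bounded height.  Everything here is PROVED (no `sorry`, no new definitions, no named
facts).

References: R. S. Hamilton, *Monotonicity formulas for parabolic flows on manifolds*, Comm. Anal. Geom. 1
(1993) 127–137 (the density behind `cylEntropy`).
-/

noncomputable section

-- the prescribed namespace `Summit.SmoothPoincare4.SmoothPoincare4.…` repeats `SmoothPoincare4`
set_option linter.dupNamespace false

open MeasureTheory Set
open scoped Manifold ContDiff ENNReal Topology BigOperators

namespace Summit.SmoothPoincare4.SmoothPoincare4.Cruxes.CylinderRungTwo.KillingFlux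

open Literature.Geometry.Riemannian.SphericalCylinderEntropy (cylKernel cylDensity cylEntropy truncL
  measure_ratio_le_cylEntropy hausdorffMeasure_sphere_four_pos hausdorffMeasure_sphere_four_lt_top)

/-- **Area bound from an entropy bound**: a time slice `A = F t (M)` (`t ≥ T`) of a cylinder flow of a
compact cross-section whose typed cylinder entropy is `< 1 + ε` has area
`μH⁴(A) ≤ (1 + ε) μH⁴(S⁴)`.  The slice is compact (continuous image of `M`), hence measurable and of
bounded height, and lies in `N`; the tree's `measure_ratio_le_cylEntropy` gives
`μH⁴(A)/μH⁴(S⁴) ≤ λ_cyl(A) < 1 + ε`, and `0 < μH⁴(S⁴) < ⊤` clears the denominator. [folklore] -/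
theorem hausdorffMeasure_range_le_of_cylEntropy_lt {M : Type} [TopologicalSpace M]
    [ChartedSpace (EuclideanSpace ℝ (Fin 4)) M] [IsManifold (𝓡 4) ∞ M] [CompactSpace M]
    {F : ℝ → M → EuclideanSpace ℝ (Fin 6)} {ν : ℝ → M → EuclideanSpace ℝ (Fin 6)} {T : ℝ}
    (hflow : IsCylinderMCF M F ν T) {t : ℝ} (ht : T ≤ t) {ε : ℝ}
    (hlt : cylEntropy (Set.range (F t)) < ENNReal.ofReal (1 + ε)) :
    μH[4] (Set.range (F t)) ≤
      ENNReal.ofReal (1 + ε) * μH[4] (Metric.sphere (0 : EuclideanSpace ℝ (Fin 5)) 1) := by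
  -- the slice is a compact subset of `ℝ⁶`
  have hcont : Continuous (F t) := (hflow.isSmoothEmbedding t ht).isEmbedding.continuous
  have hK : IsCompact (Set.range (F t)) := isCompact_range hcont
  have hAm : MeasurableSet (Set.range (F t)) := hK.measurableSet
  -- it lies in `N`
  have hAN : ∀ z ∈ Set.range (F t), ∑ i : Fin 5, z (Fin.castSucc i) ^ 2 = 1 := by
    rintro z ⟨x, rfl⟩
    exact hflow.mem_cyl t ht x
  -- and has bounded height
  obtain ⟨B, hB⟩ := hK.isBounded.exists_norm_le
  have hB5 : ∀ z ∈ Set.range (F t), |z 5| ≤ B := fun z hz =>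
    (Real.norm_eq_abs (z 5)).symm.le.trans ((PiLp.norm_apply_le z 5).trans (hB z hz))
  -- entropy dominates the area ratio
  have hratio : (μH[4] (Metric.sphere (0 : EuclideanSpace ℝ (Fin 5)) 1))⁻¹ * μH[4] (Set.range (F t)) ≤
      ENNReal.ofReal (1 + ε) :=
    ((measure_ratio_le_cylEntropy hAm hAN hB5).trans_lt hlt).le
  have h0 : μH[4] (Metric.sphere (0 : EuclideanSpace ℝ (Fin 5)) 1) ≠ 0 :=
    hausdorffMeasure_sphere_four_pos.ne'
  have htop : μH[4] (Metric.sphere (0 : EuclideanSpace ℝ (Fin 5)) 1) ≠ ⊤ :=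
    hausdorffMeasure_sphere_four_lt_top.ne
  calc μH[4] (Set.range (F t))
      = μH[4] (Metric.sphere (0 : EuclideanSpace ℝ (Fin 5)) 1) *
          ((μH[4] (Metric.sphere (0 : EuclideanSpace ℝ (Fin 5)) 1))⁻¹ * μH[4] (Set.range (F t))) := by
        rw [← mul_assoc, ENNReal.mul_inv_cancel h0 htop, one_mul]
    _ ≤ μH[4] (Metric.sphere (0 : EuclideanSpace ℝ (Fin 5)) 1) * ENNReal.ofReal (1 + ε) := by
        gcongr
    _ = ENNReal.ofReal (1 + ε) * μH[4] (Metric.sphere (0 : EuclideanSpace ℝ (Fin 5)) 1) :=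
        mul_comm _ _

/-- **Registered helper `helper_areaToFloorOfRelaxation` (line `killing-flux`, crux
`CylinderEntropy.CylinderRungTwo`, stmt-SmoothPoincare4-7631): `Relaxation → AreaToFloor`, the CONVERSE
of the lead's reshape r6 cut.**  The hypothesis is the line's `Relaxation` (eventually
`λ_cyl(M_s) < 1 + ε` along an immortal cylinder flow with separating, `2`-thin slices), the conclusion
is the registered signature of `stub_areaToFloor` (some slice `M_t`, `t ≥ T`, has
`μH⁴(M_t) ≤ (1 + ε) μH⁴(S⁴)`), both verbatim.  Given `ε`, relaxation yields `t₀ ≥ T` with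
`λ_cyl(M_{t₀}) < 1 + ε`; the slice `M_{t₀}` is a compact subset of `N`, so the tree's
`measure_ratio_le_cylEntropy` gives `μH⁴(M_{t₀})/μH⁴(S⁴) ≤ λ_cyl(M_{t₀}) < 1 + ε`
(`hausdorffMeasure_range_le_of_cylEntropy_lt`).  Hence the cut `Relaxation ⇐ AreaToFloor +
HamiltonMonotonicity` loses nothing. [folklore] -/
theorem helper_areaToFloorOfRelaxation :
    (∀ (M : Type) [TopologicalSpace M] [T2Space M] [SecondCountableTopology M]
      [ChartedSpace (EuclideanSpace ℝ (Fin 4)) M] [IsManifold (𝓡 4) ∞ M] [CompactSpace M]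
      [ConnectedSpace M]
      (F : ℝ → M → EuclideanSpace ℝ (Fin 6)) (ν : ℝ → M → EuclideanSpace ℝ (Fin 6)) (T : ℝ),
      IsCylinderMCF M F ν T →
      (∀ t, T ≤ t → SeparatesEnds (Set.range (F t))) →
      (∀ t, T ≤ t → cylEntropy (Set.range (F t)) < 2) →
      ∀ ε : ℝ, 0 < ε → ∃ t₀ : ℝ, T ≤ t₀ ∧
        ∀ s, t₀ ≤ s → cylEntropy (Set.range (F s)) < ENNReal.ofReal (1 + ε)) →
    (∀ (M : Type) [TopologicalSpace M] [T2Space M] [SecondCountableTopology M]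
      [ChartedSpace (EuclideanSpace ℝ (Fin 4)) M] [IsManifold (𝓡 4) ∞ M] [CompactSpace M]
      [ConnectedSpace M]
      (F : ℝ → M → EuclideanSpace ℝ (Fin 6)) (ν : ℝ → M → EuclideanSpace ℝ (Fin 6)) (T : ℝ),
      IsCylinderMCF M F ν T →
      (∀ t, T ≤ t → SeparatesEnds (Set.range (F t))) →
      (∀ t, T ≤ t → cylEntropy (Set.range (F t)) < 2) →
      ∀ ε : ℝ, 0 < ε → ∃ t : ℝ, T ≤ t ∧
        μH[4] (Set.range (F t)) ≤
          ENNReal.ofReal (1 + ε) * μH[4] (Metric.sphere (0 : EuclideanSpace ℝ (Fin 5)) 1)) := by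
  intro hrel M _ _ _ _ _ _ _ F ν T hflow hsep hent ε hε
  obtain ⟨t₀, hTt₀, hsmall⟩ := hrel M F ν T hflow hsep hent ε hε
  exact ⟨t₀, hTt₀, hausdorffMeasure_range_le_of_cylEntropy_lt hflow hTt₀ (hsmall t₀ le_rfl)⟩

end Summit.SmoothPoincare4.SmoothPoincare4.Cruxes.CylinderRungTwo.KillingFlux

end
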